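import Literature.Geometry.Lorentzian.KerrLargeRCurrent
import HarnessLib

/-!
# The Dafermos–Rodnianski large-`r` current on Kerr: the zeroth-order term `−⅛ □_g ϖ`

(family `gr`; infrastructure for statement **gr.S24** — Dafermos–Rodnianski–Shlapentokh-Rothman,
arXiv:1402.7034 = Ann. of Math. 183 (2016), §4.6, Prop. 4.6.1; Dafermos–Rodnianski
arXiv:1010.5132, §6 — in the coefficient-field framework of `KerrSchild.waveOperator`; namespace
`Literature.Geometry.Lorentzian.KerrSchild`)

The divergence of the modified current `J^X + ¼L_ϖ` (`KerrSchild.sum_fderiv_modifiedCurrent`) has,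
besides the first-order bulk treated in `KerrLargeRCurrent.lean`, the zeroth-order term
`−⅛ (□_G ϖ) w²`. On Minkowski space the Dafermos–Rodnianski weight
`ϖ_δ = 4(s^{−1/2} − s^{−(1+δ)/2} + (δ/2)s^{−(1+2δ)/2})` (`s = |y⃗|²`) has
`−⅛ □_η ϖ_δ ≥ (δ/4) r^{−3−δ}` for `r ≥ 2^{1/δ}` (`KerrSchild.largeR_zerothOrder_lower_bound`). This
file transfers the positivity to the Kerr metric:

* `KerrSchild.waveOperator_eq_sum_sum` — the divergence-form operator expanded,
  `□_G u = ∑_{μν} (∂_μG^{μν}) ∂_νu + G^{μν} ∂_μ∂_νu` (`G` differentiable, `u ∈ C²` at the point);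
  `KerrSchild.waveOperator_sub_coeff` — linearity in the coefficients; and
  `KerrSchild.abs_waveOperator_le`, `KerrSchild.abs_waveOperator_sub_le` — the crude bound
  `|□_G u − □_{G'} u| ≤ 16 (h₁ U₁ + h₀ U₂)` from `|(G − G')^{αβ}| ≤ h₀`, `|∂_μ(G − G')^{αβ}| ≤ h₁`,
  `|∂_νu| ≤ U₁`, `|∂_μ∂_νu| ≤ U₂`;
* `KerrSchild.abs_fderiv_largeRWeight_le`, `KerrSchild.abs_fderiv_fderiv_largeRWeight_le` — the
  weight has `|∂_νϖ_δ| ≤ 18/r²`, `|∂_μ∂_νϖ_δ| ≤ 92/r³` at `r = |y⃗| ≥ 1` (`0 < δ ≤ 1`), from the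
  one-variable bounds `|φ'_δ(t)| ≤ 9 t^{−3/2}`, `|φ''_δ(t)| ≤ (37/2) t^{−5/2}` (`t ≥ 1`);
* `KerrSchild.kerr_largeR_zerothOrder_lower_bound` — for `M ≥ 0`, `0 < δ ≤ 1`, at a point with
  `|y⃗| ≥ 2^{1/δ}` and Kerr–Schild radius `r ≥ |a|`, `r > 0`:
  `−⅛ □_{g_{M,a}} ϖ_δ (x) ≥ (δ/4)|y⃗|^{−3−δ} − 8144 M/r⁴` (by the bounds `h₀ = 2M/r`,
  `h₁ = 216 M/r²` of `KerrSchildDerivativeDecay.lean`); the radius form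
  `KerrSchild.kerr_largeR_zerothOrder_lower_bound_radius` (`≥ (δ/64) r^{−3−δ} − 8144 M/r⁴` for
  `r ≥ 2^{1/δ}`); and **`KerrSchild.kerr_largeR_zerothOrder_coercive`:
  `−⅛ □_g ϖ_δ ≥ (δ/128) r^{−3−δ}` once `δ r^{1−δ} ≥ 1042432 M`** — the Kerr form of DR's
  `−⅛□ϖ ≥ b(δ) r^{−3−δ}` at large `r` (arXiv:1010.5132, §6; DRSR §4.6).

No definitions, no named facts (D-0026).

## References

* M. Dafermos, I. Rodnianski, Y. Shlapentokh-Rothman, *Decay for solutions of the wave equation on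
  Kerr exterior spacetimes III: the full subextremal case `|a| < M`*, Ann. of Math. 183 (2016),
  arXiv:1402.7034, §4.6, Prop. 4.6.1 (key `DafermosRodnianskiShlapentokhrothman2014`).
* M. Dafermos, I. Rodnianski, *Decay for solutions of the wave equation on Kerr exterior spacetimes
  I–II: the cases `|a| ≪ M` or axisymmetry*, arXiv:1010.5132, §6 (key `DafermosRodnianski2010`).
-/

noncomputable section

open Set Filter
open scoped Topology Real

namespace Literature.Geometry.Lorentzian

namespace KerrSchild

/-! ### The divergence-form operator expanded; perturbation of the coefficients -/

/-- **The wave operator expanded**: for a coefficient field differentiable at `x` and `u` of class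
`C²` at `x`, `□_G u (x) = ∑_{μν} (∂_μ G^{μν})(x) ∂_νu(x) + G^{μν}(x) ∂_μ∂_νu(x)` (product rule in
`∑_μ ∂_μ(∑_ν G^{μν}∂_νu)`). [folklore] -/
theorem waveOperator_eq_sum_sum {G : E4 → Fin 4 → Fin 4 → ℝ} {u : E4 → ℝ} {x : E4}
    (hG : ∀ μ ν, DifferentiableAt ℝ (fun y ↦ G y μ ν) x) (hu : ContDiffAt ℝ 2 u x) :
    waveOperator G u x =
      ∑ μ, ∑ ν, (fderiv ℝ (fun y ↦ G y μ ν) x (E4.basisVector μ) * fderiv ℝ u x (E4.basisVector ν) +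
        G x μ ν * fderiv ℝ (fderiv ℝ u) x (E4.basisVector μ) (E4.basisVector ν)) := by
  have hu2 : DifferentiableAt ℝ (fderiv ℝ u) x :=
    (hu.fderiv_right (m := 1) le_rfl).differentiableAt one_ne_zero
  have hdP : ∀ κ, HasFDerivAt (fun y ↦ fderiv ℝ u y (E4.basisVector κ))
      ((fderiv ℝ (fderiv ℝ u) x).flip (E4.basisVector κ)) x := by
    intro κ
    have := hu2.hasFDerivAt.clm_apply (hasFDerivAt_const (E4.basisVector κ) x)
    simpa using this
  rw [waveOperator_apply]
  refine Finset.sum_congr rfl fun μ _ ↦ ?_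
  have h : HasFDerivAt (fun y ↦ ∑ ν, G y μ ν * fderiv ℝ u y (E4.basisVector ν))
      (∑ ν, (G x μ ν • (fderiv ℝ (fderiv ℝ u) x).flip (E4.basisVector ν) +
        fderiv ℝ u x (E4.basisVector ν) • fderiv ℝ (fun y ↦ G y μ ν) x)) x :=
    HasFDerivAt.fun_sum fun ν _ ↦ (hG μ ν).hasFDerivAt.mul (hdP ν)
  rw [h.fderiv]
  simp only [sum_apply, add_apply, smul_apply, smul_eq_mul, ContinuousLinearMap.flip_apply]
  exact Finset.sum_congr rfl fun ν _ ↦ by ring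

/-- **Crude bound for the wave operator in terms of sup bounds**: if `|H^{μν}(x)| ≤ h₀`,
`|∂_μH^{μν}(x)| ≤ h₁`, `|∂_νu(x)| ≤ U₁` and `|∂_μ∂_νu(x)| ≤ U₂`, then `|□_H u (x)| ≤ 16(h₁U₁ + h₀U₂)`
(sixteen terms). [folklore] -/
theorem abs_waveOperator_le {H : E4 → Fin 4 → Fin 4 → ℝ} {u : E4 → ℝ} {x : E4}
    (hHd : ∀ μ ν, DifferentiableAt ℝ (fun y ↦ H y μ ν) x) (hu : ContDiffAt ℝ 2 u x)
    {h₀ h₁ U₁ U₂ : ℝ} (hH : ∀ μ ν, |H x μ ν| ≤ h₀)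
    (hdH : ∀ μ α β, |fderiv ℝ (fun y ↦ H y α β) x (E4.basisVector μ)| ≤ h₁)
    (hU₁ : ∀ ν, |fderiv ℝ u x (E4.basisVector ν)| ≤ U₁)
    (hU₂ : ∀ μ ν, |fderiv ℝ (fderiv ℝ u) x (E4.basisVector μ) (E4.basisVector ν)| ≤ U₂) :
    |waveOperator H u x| ≤ 16 * (h₁ * U₁ + h₀ * U₂) := by
  rw [waveOperator_eq_sum_sum hHd hu]
  have hh₀ : 0 ≤ h₀ := (abs_nonneg _).trans (hH 0 0)
  have hU₁0 : 0 ≤ U₁ := (abs_nonneg _).trans (hU₁ 0)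
  have hterm : ∀ μ ν, |fderiv ℝ (fun y ↦ H y μ ν) x (E4.basisVector μ) * fderiv ℝ u x (E4.basisVector ν) +
      H x μ ν * fderiv ℝ (fderiv ℝ u) x (E4.basisVector μ) (E4.basisVector ν)| ≤ h₁ * U₁ + h₀ * U₂ := by
    intro μ ν
    calc _ ≤ |fderiv ℝ (fun y ↦ H y μ ν) x (E4.basisVector μ) * fderiv ℝ u x (E4.basisVector ν)| +
          |H x μ ν * fderiv ℝ (fderiv ℝ u) x (E4.basisVector μ) (E4.basisVector ν)| := abs_add_le _ _
      _ ≤ h₁ * U₁ + h₀ * U₂ := by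
          rw [abs_mul, abs_mul]
          exact add_le_add (mul_le_mul (hdH μ μ ν) (hU₁ ν) (abs_nonneg _) ((abs_nonneg _).trans (hdH μ μ ν)))
            (mul_le_mul (hH μ ν) (hU₂ μ ν) (abs_nonneg _) hh₀)
  calc _ ≤ ∑ μ, |∑ ν, (fderiv ℝ (fun y ↦ H y μ ν) x (E4.basisVector μ) * fderiv ℝ u x (E4.basisVector ν) +
          H x μ ν * fderiv ℝ (fderiv ℝ u) x (E4.basisVector μ) (E4.basisVector ν))| :=
        Finset.abs_sum_le_sum_abs _ _
    _ ≤ ∑ μ, ∑ ν, |fderiv ℝ (fun y ↦ H y μ ν) x (E4.basisVector μ) * fderiv ℝ u x (E4.basisVector ν) +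
          H x μ ν * fderiv ℝ (fderiv ℝ u) x (E4.basisVector μ) (E4.basisVector ν)| :=
        Finset.sum_le_sum fun μ _ ↦ Finset.abs_sum_le_sum_abs _ _
    _ ≤ ∑ _μ : Fin 4, ∑ _ν : Fin 4, (h₁ * U₁ + h₀ * U₂) :=
        Finset.sum_le_sum fun μ _ ↦ Finset.sum_le_sum fun ν _ ↦ hterm μ ν
    _ = 16 * (h₁ * U₁ + h₀ * U₂) := by
        simp only [Finset.sum_const, Finset.card_univ, Fintype.card_fin, nsmul_eq_mul, Nat.cast_ofNat]
        ring

/-- **The wave operator is linear in the coefficients**: `□_G u (x) − □_{G'} u (x) = □_{G−G'} u (x)`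
for `G`, `G'` differentiable at `x` and `u ∈ C²` at `x`. [folklore] -/
theorem waveOperator_sub_coeff {G G' : E4 → Fin 4 → Fin 4 → ℝ} {u : E4 → ℝ} {x : E4}
    (hG : ∀ μ ν, DifferentiableAt ℝ (fun y ↦ G y μ ν) x)
    (hG' : ∀ μ ν, DifferentiableAt ℝ (fun y ↦ G' y μ ν) x) (hu : ContDiffAt ℝ 2 u x) :
    waveOperator G u x - waveOperator G' u x = waveOperator (G - G') u x := by
  have hH : ∀ μ ν, DifferentiableAt ℝ (fun y ↦ (G - G') y μ ν) x := fun μ ν ↦ (hG μ ν).sub (hG' μ ν)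
  rw [waveOperator_eq_sum_sum hG hu, waveOperator_eq_sum_sum hG' hu, waveOperator_eq_sum_sum hH hu,
    ← Finset.sum_sub_distrib]
  refine Finset.sum_congr rfl fun μ _ ↦ ?_
  rw [← Finset.sum_sub_distrib]
  refine Finset.sum_congr rfl fun ν _ ↦ ?_
  have hsub : fderiv ℝ (fun y ↦ (G - G') y μ ν) x =
      fderiv ℝ (fun y ↦ G y μ ν) x - fderiv ℝ (fun y ↦ G' y μ ν) x :=
    fderiv_sub (hG μ ν) (hG' μ ν)
  rw [hsub]
  simp only [sub_apply, Pi.sub_apply]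
  ring

/-- **Perturbation of the coefficients in the wave operator**: with `|(G − G')^{μν}(x)| ≤ h₀`,
`|∂_μ(G − G')^{μν}(x)| ≤ h₁`, `|∂_νu(x)| ≤ U₁`, `|∂_μ∂_νu(x)| ≤ U₂`:
`|□_G u (x) − □_{G'} u (x)| ≤ 16(h₁U₁ + h₀U₂)`. For `G = g⁻¹_{M,a}`, `G' = η⁻¹` and the DR weight
`u = ϖ` (`U₁ = O(r^{−2})`, `U₂ = O(r^{−3})`, `h₀ = O(M/r)`, `h₁ = O(M/r²)`) the difference is
`O(M r^{−4})`, dominated by `−⅛□_ηϖ ∼ δ r^{−3−δ}` for large `r` — the zeroth-order half of "this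
inequality is preserved when `X`, `w` are defined for `g_{M,a}`" (DRSR arXiv:1402.7034, §4.6;
Dafermos–Rodnianski arXiv:1010.5132, §6). [cite: DafermosRodnianskiShlapentokhrothman2014, §4.6] -/
theorem abs_waveOperator_sub_le {G G' : E4 → Fin 4 → Fin 4 → ℝ} {u : E4 → ℝ} {x : E4}
    (hG : ∀ μ ν, DifferentiableAt ℝ (fun y ↦ G y μ ν) x)
    (hG' : ∀ μ ν, DifferentiableAt ℝ (fun y ↦ G' y μ ν) x) (hu : ContDiffAt ℝ 2 u x)
    {h₀ h₁ U₁ U₂ : ℝ} (hH : ∀ μ ν, |(G - G') x μ ν| ≤ h₀)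
    (hdH : ∀ μ α β, |fderiv ℝ (fun y ↦ (G - G') y α β) x (E4.basisVector μ)| ≤ h₁)
    (hU₁ : ∀ ν, |fderiv ℝ u x (E4.basisVector ν)| ≤ U₁)
    (hU₂ : ∀ μ ν, |fderiv ℝ (fderiv ℝ u) x (E4.basisVector μ) (E4.basisVector ν)| ≤ U₂) :
    |waveOperator G u x - waveOperator G' u x| ≤ 16 * (h₁ * U₁ + h₀ * U₂) := by
  rw [waveOperator_sub_coeff hG hG' hu]
  exact abs_waveOperator_le (fun μ ν ↦ (hG μ ν).sub (hG' μ ν)) hu hH hdH hU₁ hU₂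

/-! ### The one-variable weight function `φ_δ(t) = 4(t^{−1/2} − t^{−(1+δ)/2} + (δ/2)t^{−(1+2δ)/2})` -/

/-- `φ_δ` is smooth at every `t > 0`. [folklore] -/
theorem contDiffAt_largeRWeightFn (δ : ℝ) {t : ℝ} (ht : 0 < t) {n : WithTop ℕ∞} :
    ContDiffAt ℝ n (fun u : ℝ ↦ 4 * (u ^ (-(1 / 2 : ℝ)) - u ^ (-((1 + δ) / 2)) +
      δ / 2 * u ^ (-((1 + 2 * δ) / 2)))) t := by
  have h := fun b : ℝ ↦ (Real.contDiffAt_rpow_const_of_ne (p := -b) (n := n) ht.ne')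
  exact contDiffAt_const.mul (((h _).sub (h _)).add (contDiffAt_const.mul (h _)))

/-- The derivative of `φ_δ` at `t > 0`:
`φ'_δ(t) = 4(−½ t^{−3/2} + ((1+δ)/2) t^{−(3+δ)/2} − (δ(1+2δ)/4) t^{−(3+2δ)/2})`. [folklore] -/
theorem hasDerivAt_largeRWeightFn (δ : ℝ) {t : ℝ} (ht : 0 < t) :
    HasDerivAt (fun u : ℝ ↦ 4 * (u ^ (-(1 / 2 : ℝ)) - u ^ (-((1 + δ) / 2)) +
      δ / 2 * u ^ (-((1 + 2 * δ) / 2))))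
      (4 * (-(1 / 2 : ℝ) * t ^ (-(1 / 2 : ℝ) - 1) - -((1 + δ) / 2) * t ^ (-((1 + δ) / 2) - 1) +
        δ / 2 * (-((1 + 2 * δ) / 2) * t ^ (-((1 + 2 * δ) / 2) - 1)))) t := by
  have hpow : ∀ b : ℝ, HasDerivAt (fun u : ℝ ↦ u ^ (-b)) (-b * t ^ (-b - 1)) t :=
    fun b ↦ Real.hasDerivAt_rpow_const (Or.inl ht.ne')
  exact (((hpow _).sub (hpow _)).add ((hpow _).const_mul _)).const_mul 4

/-- The derivative of `φ'_δ` at `t > 0` (the second derivative of `φ_δ`). [folklore] -/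
theorem hasDerivAt_largeRWeightFn_deriv (δ : ℝ) {t : ℝ} (ht : 0 < t) :
    HasDerivAt (fun u : ℝ ↦ 4 * (-(1 / 2 : ℝ) * u ^ (-(1 / 2 : ℝ) - 1) -
        -((1 + δ) / 2) * u ^ (-((1 + δ) / 2) - 1) +
          δ / 2 * (-((1 + 2 * δ) / 2) * u ^ (-((1 + 2 * δ) / 2) - 1))))
      (4 * (-(1 / 2 : ℝ) * ((-(1 / 2 : ℝ) - 1) * t ^ (-(1 / 2 : ℝ) - 1 - 1)) -
        -((1 + δ) / 2) * ((-((1 + δ) / 2) - 1) * t ^ (-((1 + δ) / 2) - 1 - 1)) +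
          δ / 2 * (-((1 + 2 * δ) / 2) * ((-((1 + 2 * δ) / 2) - 1) *
            t ^ (-((1 + 2 * δ) / 2) - 1 - 1))))) t := by
  have hpow' : ∀ b : ℝ, HasDerivAt (fun u : ℝ ↦ u ^ (-b - 1)) ((-b - 1) * t ^ (-b - 1 - 1)) t :=
    fun b ↦ Real.hasDerivAt_rpow_const (Or.inl ht.ne')
  exact ((((hpow' _).const_mul _).sub ((hpow' _).const_mul _)).add
    (((hpow' _).const_mul _).const_mul _)).const_mul 4

/-- **`|φ'_δ(t)| ≤ 9 t^{−3/2}` for `t ≥ 1`, `0 < δ ≤ 1`** (each power is at most `t^{−3/2}`, the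
coefficients are at most `½`, `1`, `¾`). [folklore] -/
theorem abs_largeRWeightFn_deriv_le {δ t : ℝ} (hδ0 : 0 < δ) (hδ1 : δ ≤ 1) (ht : 1 ≤ t) :
    |4 * (-(1 / 2 : ℝ) * t ^ (-(1 / 2 : ℝ) - 1) - -((1 + δ) / 2) * t ^ (-((1 + δ) / 2) - 1) +
        δ / 2 * (-((1 + 2 * δ) / 2) * t ^ (-((1 + 2 * δ) / 2) - 1)))| ≤ 9 * t ^ (-(3 / 2 : ℝ)) := by
  have hT0 : 0 ≤ t ^ (-(3 / 2 : ℝ)) := Real.rpow_nonneg (by linarith) _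
  have h1 : t ^ (-(1 / 2 : ℝ) - 1) = t ^ (-(3 / 2 : ℝ)) := by norm_num
  have h2 : t ^ (-((1 + δ) / 2) - 1) ≤ t ^ (-(3 / 2 : ℝ)) :=
    Real.rpow_le_rpow_of_exponent_le ht (by linarith)
  have h2' : 0 ≤ t ^ (-((1 + δ) / 2) - 1) := Real.rpow_nonneg (by linarith) _
  have h3 : t ^ (-((1 + 2 * δ) / 2) - 1) ≤ t ^ (-(3 / 2 : ℝ)) :=
    Real.rpow_le_rpow_of_exponent_le ht (by linarith)
  have h3' : 0 ≤ t ^ (-((1 + 2 * δ) / 2) - 1) := Real.rpow_nonneg (by linarith) _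
  rw [h1]
  have hb2 : (1 + δ) / 2 * t ^ (-((1 + δ) / 2) - 1) ≤ 1 * t ^ (-(3 / 2 : ℝ)) :=
    mul_le_mul (by linarith) h2 h2' zero_le_one
  have hb2' : 0 ≤ (1 + δ) / 2 * t ^ (-((1 + δ) / 2) - 1) := mul_nonneg (by linarith) h2'
  have hb3 : δ / 2 * ((1 + 2 * δ) / 2) * t ^ (-((1 + 2 * δ) / 2) - 1) ≤ 3 / 4 * t ^ (-(3 / 2 : ℝ)) :=
    mul_le_mul (by nlinarith) h3 h3' (by norm_num)
  have hb3' : 0 ≤ δ / 2 * ((1 + 2 * δ) / 2) * t ^ (-((1 + 2 * δ) / 2) - 1) :=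
    mul_nonneg (by positivity) h3'
  rw [abs_le]
  constructor
  · linarith
  · linarith

/-- **`|φ''_δ(t)| ≤ (37/2) t^{−5/2}` for `t ≥ 1`, `0 < δ ≤ 1`** (coefficients at most `¾`, `2`,
`15/8`). [folklore] -/
theorem abs_largeRWeightFn_deriv2_le {δ t : ℝ} (hδ0 : 0 < δ) (hδ1 : δ ≤ 1) (ht : 1 ≤ t) :
    |4 * (-(1 / 2 : ℝ) * ((-(1 / 2 : ℝ) - 1) * t ^ (-(1 / 2 : ℝ) - 1 - 1)) -
        -((1 + δ) / 2) * ((-((1 + δ) / 2) - 1) * t ^ (-((1 + δ) / 2) - 1 - 1)) +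
          δ / 2 * (-((1 + 2 * δ) / 2) * ((-((1 + 2 * δ) / 2) - 1) *
            t ^ (-((1 + 2 * δ) / 2) - 1 - 1))))| ≤ 37 / 2 * t ^ (-(5 / 2 : ℝ)) := by
  have hT0 : 0 ≤ t ^ (-(5 / 2 : ℝ)) := Real.rpow_nonneg (by linarith) _
  have h1 : t ^ (-(1 / 2 : ℝ) - 1 - 1) = t ^ (-(5 / 2 : ℝ)) := by norm_num
  have h2 : t ^ (-((1 + δ) / 2) - 1 - 1) ≤ t ^ (-(5 / 2 : ℝ)) :=
    Real.rpow_le_rpow_of_exponent_le ht (by linarith)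
  have h2' : 0 ≤ t ^ (-((1 + δ) / 2) - 1 - 1) := Real.rpow_nonneg (by linarith) _
  have h3 : t ^ (-((1 + 2 * δ) / 2) - 1 - 1) ≤ t ^ (-(5 / 2 : ℝ)) :=
    Real.rpow_le_rpow_of_exponent_le ht (by linarith)
  have h3' : 0 ≤ t ^ (-((1 + 2 * δ) / 2) - 1 - 1) := Real.rpow_nonneg (by linarith) _
  rw [h1]
  have hb2 : (1 + δ) / 2 * ((1 + δ) / 2 + 1) * t ^ (-((1 + δ) / 2) - 1 - 1) ≤ 2 * t ^ (-(5 / 2 : ℝ)) :=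
    mul_le_mul (by nlinarith) h2 h2' (by norm_num)
  have hb2' : 0 ≤ (1 + δ) / 2 * ((1 + δ) / 2 + 1) * t ^ (-((1 + δ) / 2) - 1 - 1) :=
    mul_nonneg (by positivity) h2'
  have hprod : δ / 2 * ((1 + 2 * δ) / 2) * ((1 + 2 * δ) / 2 + 1) ≤ 15 / 8 := by
    have ha : δ / 2 ≤ 1 / 2 := by linarith
    have hb : (1 + 2 * δ) / 2 ≤ 3 / 2 := by linarith
    have hc : (1 + 2 * δ) / 2 + 1 ≤ 5 / 2 := by linarith
    calc δ / 2 * ((1 + 2 * δ) / 2) * ((1 + 2 * δ) / 2 + 1) ≤ 1 / 2 * (3 / 2) * (5 / 2) := by gcongr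
      _ = 15 / 8 := by norm_num
  have hb3 : δ / 2 * ((1 + 2 * δ) / 2) * ((1 + 2 * δ) / 2 + 1) * t ^ (-((1 + 2 * δ) / 2) - 1 - 1) ≤
      15 / 8 * t ^ (-(5 / 2 : ℝ)) :=
    mul_le_mul hprod h3 h3' (by norm_num)
  have hb3' : 0 ≤ δ / 2 * ((1 + 2 * δ) / 2) * ((1 + 2 * δ) / 2 + 1) * t ^ (-((1 + 2 * δ) / 2) - 1 - 1) :=
    mul_nonneg (by positivity) h3'
  rw [abs_le]
  constructor
  · nlinarith
  · nlinarith

/-! ### The weight on `E4`: smoothness and the decay of its first two derivatives -/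

/-- `t ↦ t` powers at `t = r²`: `(r²)^{−3/2} = r⁻³` and `(r²)^{−5/2} = r⁻⁵` for `r > 0`. [folklore] -/
theorem sq_rpow_neg_three_halves {r : ℝ} (hr : 0 < r) : (r ^ 2) ^ (-(3 / 2 : ℝ)) = (r ^ 3)⁻¹ ∧
    (r ^ 2) ^ (-(5 / 2 : ℝ)) = (r ^ 5)⁻¹ := by
  constructor
  · rw [← Real.rpow_two, ← Real.rpow_mul hr.le, show (2 : ℝ) * -(3 / 2) = -(3 : ℝ) by norm_num,
      Real.rpow_neg hr.le, show (3 : ℝ) = ((3 : ℕ) : ℝ) by norm_num, Real.rpow_natCast]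
  · rw [← Real.rpow_two, ← Real.rpow_mul hr.le, show (2 : ℝ) * -(5 / 2) = -(5 : ℝ) by norm_num,
      Real.rpow_neg hr.le, show (5 : ℝ) = ((5 : ℕ) : ℝ) by norm_num, Real.rpow_natCast]

/-- **The DR weight is `C^n` off the time axis** (`s > 0`). [cite: DafermosRodnianski2010, §6] -/
theorem contDiffAt_largeRWeight (δ : ℝ) {x : E4} (hx : 0 < E4.spatialNorm x) {n : WithTop ℕ∞} :
    ContDiffAt ℝ n (fun y : E4 ↦ 4 * ((E4.spatialNorm y ^ 2) ^ (-(1 / 2 : ℝ)) -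
      (E4.spatialNorm y ^ 2) ^ (-((1 + δ) / 2)) + δ / 2 * (E4.spatialNorm y ^ 2) ^ (-((1 + 2 * δ) / 2)))) x := by
  have hs : 0 < E4.spatialNorm x ^ 2 := by positivity
  have h := (contDiffAt_largeRWeightFn δ hs (n := n)).comp x (Kerr.contDiff_spatialNorm_sq.contDiffAt)
  exact h

/-- **The first derivatives of the DR weight**: at a point with `s = |y⃗|² > 0`,
`∂_νϖ_δ(y) = φ'_δ(s) · (2y_ν)` for spatial `ν` and `∂₀ϖ_δ = 0` (chain rule through `s`,
`KerrSchild.hasFDerivAt_spatialNormSq`). [cite: DafermosRodnianski2010, §6] -/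
theorem fderiv_largeRWeight_apply (δ : ℝ) {y : E4} (hy : 0 < E4.spatialNorm y) (ν : Fin 4) :
    fderiv ℝ (fun y : E4 ↦ 4 * ((E4.spatialNorm y ^ 2) ^ (-(1 / 2 : ℝ)) -
      (E4.spatialNorm y ^ 2) ^ (-((1 + δ) / 2)) + δ / 2 * (E4.spatialNorm y ^ 2) ^ (-((1 + 2 * δ) / 2)))) y (E4.basisVector ν) =
      4 * (-(1 / 2 : ℝ) * (E4.spatialNorm y ^ 2) ^ (-(1 / 2 : ℝ) - 1) -
          -((1 + δ) / 2) * (E4.spatialNorm y ^ 2) ^ (-((1 + δ) / 2) - 1) +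
            δ / 2 * (-((1 + 2 * δ) / 2) * (E4.spatialNorm y ^ 2) ^ (-((1 + 2 * δ) / 2) - 1))) *
        (if ν = 0 then 0 else 2 * y ν) := by
  have hs : 0 < E4.spatialNorm y ^ 2 := by positivity
  have hcomp := (hasDerivAt_largeRWeightFn δ hs).comp_hasFDerivAt y (hasFDerivAt_spatialNormSq y)
  have hcomp' : HasFDerivAt (fun y : E4 ↦ 4 * ((E4.spatialNorm y ^ 2) ^ (-(1 / 2 : ℝ)) -
      (E4.spatialNorm y ^ 2) ^ (-((1 + δ) / 2)) + δ / 2 * (E4.spatialNorm y ^ 2) ^ (-((1 + 2 * δ) / 2)))) _ y := hcomp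
  rw [hcomp'.fderiv]
  simp only [smul_apply, add_apply, smul_eq_mul, Kerr.dx_basisVector]
  fin_cases ν <;> simp

/-- **`|∂_νϖ_δ| ≤ 18/r²`** at `r = |y⃗| ≥ 1`, `0 < δ ≤ 1` (`|φ'_δ(r²)| ≤ 9/r³`, `|2y_ν| ≤ 2r`).
[cite: DafermosRodnianski2010, §6] -/
theorem abs_fderiv_largeRWeight_le {δ : ℝ} (hδ0 : 0 < δ) (hδ1 : δ ≤ 1) {x : E4}
    (hx1 : 1 ≤ E4.spatialNorm x) (ν : Fin 4) :
    |fderiv ℝ (fun y : E4 ↦ 4 * ((E4.spatialNorm y ^ 2) ^ (-(1 / 2 : ℝ)) -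
      (E4.spatialNorm y ^ 2) ^ (-((1 + δ) / 2)) + δ / 2 * (E4.spatialNorm y ^ 2) ^ (-((1 + 2 * δ) / 2)))) x (E4.basisVector ν)| ≤ 18 / E4.spatialNorm x ^ 2 := by
  have hr : 0 < E4.spatialNorm x := one_pos.trans_le hx1
  rw [fderiv_largeRWeight_apply δ hr ν, abs_mul]
  have hφ := abs_largeRWeightFn_deriv_le hδ0 hδ1 (by nlinarith : 1 ≤ E4.spatialNorm x ^ 2)
  rw [(sq_rpow_neg_three_halves hr).1] at hφ
  have hv : |(if ν = 0 then (0 : ℝ) else 2 * x ν)| ≤ 2 * E4.spatialNorm x := by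
    split_ifs with hν
    · rw [abs_zero]; positivity
    · rw [abs_mul, abs_two]
      exact mul_le_mul_of_nonneg_left (abs_apply_le_spatialNorm x hν) two_pos.le
  calc _ ≤ 9 * (E4.spatialNorm x ^ 3)⁻¹ * (2 * E4.spatialNorm x) :=
        mul_le_mul hφ hv (abs_nonneg _) (by positivity)
    _ = 18 / E4.spatialNorm x ^ 2 := by field_simp; norm_num

/-- **The second derivatives of the DR weight**: at a point with `s = |y⃗|²(x) > 0`,
`∂_μ∂_νϖ_δ(x) = 2φ''_δ(s)(2x_μ)x_ν + 2φ'_δ(s) δ_{μν}` for spatial `μ, ν` (and `0` if `ν = 0`),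
computed as `∂_μ` of the radial vector field `y ↦ 2φ'_δ(s) y_ν = ∂_νϖ_δ` near `x`
(`KerrSchild.fderiv_radialMultiplier_apply`). [cite: DafermosRodnianski2010, §6] -/
theorem fderiv_fderiv_largeRWeight_apply (δ : ℝ) {x : E4} (hx : 0 < E4.spatialNorm x) (μ ν : Fin 4) :
    fderiv ℝ (fderiv ℝ (fun y : E4 ↦ 4 * ((E4.spatialNorm y ^ 2) ^ (-(1 / 2 : ℝ)) -
      (E4.spatialNorm y ^ 2) ^ (-((1 + δ) / 2)) + δ / 2 * (E4.spatialNorm y ^ 2) ^ (-((1 + 2 * δ) / 2))))) x (E4.basisVector μ) (E4.basisVector ν) =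
      if ν = 0 then 0 else
        2 * (4 * (-(1 / 2 : ℝ) * ((-(1 / 2 : ℝ) - 1) * (E4.spatialNorm x ^ 2) ^ (-(1 / 2 : ℝ) - 1 - 1)) -
            -((1 + δ) / 2) * ((-((1 + δ) / 2) - 1) * (E4.spatialNorm x ^ 2) ^ (-((1 + δ) / 2) - 1 - 1)) +
              δ / 2 * (-((1 + 2 * δ) / 2) * ((-((1 + 2 * δ) / 2) - 1) *
                (E4.spatialNorm x ^ 2) ^ (-((1 + 2 * δ) / 2) - 1 - 1))))) *
            (if μ = 0 then 0 else 2 * x μ) * x ν +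
          2 * (4 * (-(1 / 2 : ℝ) * (E4.spatialNorm x ^ 2) ^ (-(1 / 2 : ℝ) - 1) -
            -((1 + δ) / 2) * (E4.spatialNorm x ^ 2) ^ (-((1 + δ) / 2) - 1) +
              δ / 2 * (-((1 + 2 * δ) / 2) * (E4.spatialNorm x ^ 2) ^ (-((1 + 2 * δ) / 2) - 1)))) *
            (if ν = μ then 1 else 0) := by
  have hs : 0 < E4.spatialNorm x ^ 2 := by positivity
  -- `∂_μ∂_ν ϖ = ∂_μ (y ↦ ∂_ν ϖ(y))`
  have h2 : ContDiffAt ℝ 2 (fun y : E4 ↦ 4 * ((E4.spatialNorm y ^ 2) ^ (-(1 / 2 : ℝ)) -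
      (E4.spatialNorm y ^ 2) ^ (-((1 + δ) / 2)) + δ / 2 * (E4.spatialNorm y ^ 2) ^ (-((1 + 2 * δ) / 2)))) x := contDiffAt_largeRWeight δ hx
  have hu2 : DifferentiableAt ℝ (fderiv ℝ (fun y : E4 ↦ 4 * ((E4.spatialNorm y ^ 2) ^ (-(1 / 2 : ℝ)) -
      (E4.spatialNorm y ^ 2) ^ (-((1 + δ) / 2)) + δ / 2 * (E4.spatialNorm y ^ 2) ^ (-((1 + 2 * δ) / 2))))) x :=
    (h2.fderiv_right (m := 1) le_rfl).differentiableAt one_ne_zero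
  have hP : HasFDerivAt (fun y ↦ fderiv ℝ (fun y : E4 ↦ 4 * ((E4.spatialNorm y ^ 2) ^ (-(1 / 2 : ℝ)) -
      (E4.spatialNorm y ^ 2) ^ (-((1 + δ) / 2)) + δ / 2 * (E4.spatialNorm y ^ 2) ^ (-((1 + 2 * δ) / 2)))) y (E4.basisVector ν))
      ((fderiv ℝ (fderiv ℝ (fun y : E4 ↦ 4 * ((E4.spatialNorm y ^ 2) ^ (-(1 / 2 : ℝ)) -
      (E4.spatialNorm y ^ 2) ^ (-((1 + δ) / 2)) + δ / 2 * (E4.spatialNorm y ^ 2) ^ (-((1 + 2 * δ) / 2))))) x).flip (E4.basisVector ν)) x := by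
    have := hu2.hasFDerivAt.clm_apply (hasFDerivAt_const (E4.basisVector ν) x)
    simpa using this
  have hflip : fderiv ℝ (fderiv ℝ (fun y : E4 ↦ 4 * ((E4.spatialNorm y ^ 2) ^ (-(1 / 2 : ℝ)) -
      (E4.spatialNorm y ^ 2) ^ (-((1 + δ) / 2)) + δ / 2 * (E4.spatialNorm y ^ 2) ^ (-((1 + 2 * δ) / 2))))) x (E4.basisVector μ) (E4.basisVector ν) =
      fderiv ℝ (fun y ↦ fderiv ℝ (fun y : E4 ↦ 4 * ((E4.spatialNorm y ^ 2) ^ (-(1 / 2 : ℝ)) -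
      (E4.spatialNorm y ^ 2) ^ (-((1 + δ) / 2)) + δ / 2 * (E4.spatialNorm y ^ 2) ^ (-((1 + 2 * δ) / 2)))) y (E4.basisVector ν)) x (E4.basisVector μ) := by
    rw [hP.fderiv, ContinuousLinearMap.flip_apply]
  rw [hflip]
  -- near `x`, `∂_ν ϖ` is the radial vector field with profile `2φ'`
  have hopen : IsOpen {y : E4 | 0 < E4.spatialNorm y} :=
    isOpen_lt continuous_const (continuous_norm.comp E4.spatial.continuous)
  have hnear : (fun y ↦ fderiv ℝ (fun y : E4 ↦ 4 * ((E4.spatialNorm y ^ 2) ^ (-(1 / 2 : ℝ)) -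
      (E4.spatialNorm y ^ 2) ^ (-((1 + δ) / 2)) + δ / 2 * (E4.spatialNorm y ^ 2) ^ (-((1 + 2 * δ) / 2)))) y (E4.basisVector ν)) =ᶠ[𝓝 x]
      fun y ↦ if ν = 0 then (0 : ℝ) else
        (fun t : ℝ ↦ 2 * (4 * (-(1 / 2 : ℝ) * t ^ (-(1 / 2 : ℝ) - 1) -
          -((1 + δ) / 2) * t ^ (-((1 + δ) / 2) - 1) +
            δ / 2 * (-((1 + 2 * δ) / 2) * t ^ (-((1 + 2 * δ) / 2) - 1)))))
          (E4.spatialNorm y ^ 2) * y ν := by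
    filter_upwards [hopen.mem_nhds hx] with y hy
    rw [fderiv_largeRWeight_apply δ hy ν]
    split_ifs <;> ring
  rw [hnear.fderiv_eq]
  have hg := (hasDerivAt_largeRWeightFn_deriv δ hs).const_mul 2
  rw [fderiv_radialMultiplier_apply hg ν μ]

/-- **`|∂_μ∂_νϖ_δ| ≤ 92/r³`** at `r = |y⃗| ≥ 1`, `0 < δ ≤ 1`
(`2|φ''|(2r)r + 2|φ'| ≤ 74/r³ + 18/r³`). [cite: DafermosRodnianski2010, §6] -/
theorem abs_fderiv_fderiv_largeRWeight_le {δ : ℝ} (hδ0 : 0 < δ) (hδ1 : δ ≤ 1) {x : E4}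
    (hx1 : 1 ≤ E4.spatialNorm x) (μ ν : Fin 4) :
    |fderiv ℝ (fderiv ℝ (fun y : E4 ↦ 4 * ((E4.spatialNorm y ^ 2) ^ (-(1 / 2 : ℝ)) -
      (E4.spatialNorm y ^ 2) ^ (-((1 + δ) / 2)) + δ / 2 * (E4.spatialNorm y ^ 2) ^ (-((1 + 2 * δ) / 2))))) x (E4.basisVector μ) (E4.basisVector ν)| ≤
      92 / E4.spatialNorm x ^ 3 := by
  have hr : 0 < E4.spatialNorm x := one_pos.trans_le hx1
  have ht1 : 1 ≤ E4.spatialNorm x ^ 2 := by nlinarith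
  rw [fderiv_fderiv_largeRWeight_apply δ hr μ ν]
  by_cases hν : ν = 0
  · simp only [hν, if_true, abs_zero]
    positivity
  simp only [hν, if_false]
  have hφ1 := abs_largeRWeightFn_deriv_le hδ0 hδ1 ht1
  have hφ2 := abs_largeRWeightFn_deriv2_le hδ0 hδ1 ht1
  rw [(sq_rpow_neg_three_halves hr).1] at hφ1
  rw [(sq_rpow_neg_three_halves hr).2] at hφ2
  set r := E4.spatialNorm x with hr_def
  set F1 := 4 * (-(1 / 2 : ℝ) * (r ^ 2) ^ (-(1 / 2 : ℝ) - 1) -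
    -((1 + δ) / 2) * (r ^ 2) ^ (-((1 + δ) / 2) - 1) +
      δ / 2 * (-((1 + 2 * δ) / 2) * (r ^ 2) ^ (-((1 + 2 * δ) / 2) - 1))) with hF1
  set F2 := 4 * (-(1 / 2 : ℝ) * ((-(1 / 2 : ℝ) - 1) * (r ^ 2) ^ (-(1 / 2 : ℝ) - 1 - 1)) -
    -((1 + δ) / 2) * ((-((1 + δ) / 2) - 1) * (r ^ 2) ^ (-((1 + δ) / 2) - 1 - 1)) +
      δ / 2 * (-((1 + 2 * δ) / 2) * ((-((1 + 2 * δ) / 2) - 1) *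
        (r ^ 2) ^ (-((1 + 2 * δ) / 2) - 1 - 1)))) with hF2
  have hxμ : |(if μ = 0 then (0 : ℝ) else 2 * x μ)| ≤ 2 * r := by
    split_ifs with hμ
    · rw [abs_zero]; positivity
    · rw [abs_mul, abs_two]
      exact mul_le_mul_of_nonneg_left (abs_apply_le_spatialNorm x hμ) two_pos.le
  have hxν : |x ν| ≤ r := abs_apply_le_spatialNorm x hν
  have hind : |(if ν = μ then (1 : ℝ) else 0)| ≤ 1 := by split_ifs <;> simp
  have h1 : |2 * F2 * (if μ = 0 then 0 else 2 * x μ) * x ν| ≤ 74 / r ^ 3 := by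
    rw [abs_mul, abs_mul, abs_mul, abs_two]
    calc 2 * |F2| * |(if μ = 0 then (0 : ℝ) else 2 * x μ)| * |x ν|
        ≤ 2 * (37 / 2 * (r ^ 5)⁻¹) * (2 * r) * r := by gcongr
      _ = 74 / r ^ 3 := by field_simp; ring
  have h2 : |2 * F1 * (if ν = μ then 1 else 0)| ≤ 18 / r ^ 3 := by
    rw [abs_mul, abs_mul, abs_two]
    calc 2 * |F1| * |(if ν = μ then (1 : ℝ) else 0)| ≤ 2 * (9 * (r ^ 3)⁻¹) * 1 := by gcongr
      _ = 18 / r ^ 3 := by field_simp; ring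
  calc _ ≤ |2 * F2 * (if μ = 0 then 0 else 2 * x μ) * x ν| + |2 * F1 * (if ν = μ then 1 else 0)| :=
        abs_add_le _ _
    _ ≤ 74 / r ^ 3 + 18 / r ^ 3 := add_le_add h1 h2
    _ = 92 / r ^ 3 := by ring

/-! ### The zeroth-order term of the large-`r` current on Kerr -/

/-- **Positivity of the zeroth-order term on Kerr.** Let `M ≥ 0`, `0 < δ ≤ 1`, and let `x` be a
point with `|y⃗|(x) ≥ 2^{1/δ}` whose Kerr–Schild radius satisfies `r = r(x) > 0`, `r ≥ |a|`. Then
`−⅛ □_{g_{M,a}} ϖ_δ (x) ≥ (δ/4)|y⃗|^{−3−δ} − 8144 M/r⁴`: the Minkowski model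
`KerrSchild.largeR_zerothOrder_lower_bound` plus `⅛|□_gϖ − □_ηϖ| ≤ 2(h₁·18/|y⃗|² + h₀·92/|y⃗|³)`
with `h₀ = 2M/r`, `h₁ = 216M/r²` (`KerrSchildDerivativeDecay.lean`) and `|y⃗| ≥ r`. DRSR
arXiv:1402.7034, §4.6; Dafermos–Rodnianski arXiv:1010.5132, §6.
[cite: DafermosRodnianskiShlapentokhrothman2014, §4.6] -/
theorem kerr_largeR_zerothOrder_lower_bound {δ M a : ℝ} (hδ0 : 0 < δ) (hδ1 : δ ≤ 1) (hM : 0 ≤ M)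
    {x : E4} (hx : (2 : ℝ) ^ (1 / δ) ≤ E4.spatialNorm x) (hr : 0 < Kerr.radius a x)
    (hax : |a| ≤ Kerr.radius a x) :
    δ / 4 * E4.spatialNorm x ^ (-3 - δ) - 8144 * M / Kerr.radius a x ^ 4 ≤
      -8⁻¹ * waveOperator (Kerr.inverseMetric M a) (fun y : E4 ↦ 4 * ((E4.spatialNorm y ^ 2) ^ (-(1 / 2 : ℝ)) -
      (E4.spatialNorm y ^ 2) ^ (-((1 + δ) / 2)) + δ / 2 * (E4.spatialNorm y ^ 2) ^ (-((1 + 2 * δ) / 2)))) x := by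
  -- the two radii `ρ = |y⃗| ≥ rK = r(x) > 0`
  have h2 : 0 < (2 : ℝ) ^ (1 / δ) := Real.rpow_pos_of_pos (by norm_num) _
  have h21 : (1 : ℝ) ≤ (2 : ℝ) ^ (1 / δ) := Real.one_le_rpow (by norm_num) (by positivity)
  have hρ1 : 1 ≤ E4.spatialNorm x := h21.trans hx
  have hρ : 0 < E4.spatialNorm x := one_pos.trans_le hρ1
  have hrρ : Kerr.radius a x ≤ E4.spatialNorm x := by
    have hr' : 0 < Kerr.radius a (E4.ofTimeSpace 0 (E4.spatial x)) := by
      rwa [Kerr.radius_ofTimeSpace_spatial]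
    have h := Kerr.radius_le_norm hr'
    rwa [Kerr.radius_ofTimeSpace_spatial] at h
  -- model and perturbation
  have hmodel := largeR_zerothOrder_lower_bound hδ0 hδ1 hx
  have hG : ∀ α β, DifferentiableAt ℝ (fun y ↦ Kerr.inverseMetric M a y α β) x := fun α β ↦
    (Kerr.contDiffAt_inverseMetric M a hr α β (n := 1)).differentiableAt one_ne_zero
  have hG' : ∀ α β, DifferentiableAt ℝ (fun y ↦ (fun _ : E4 ↦ Kerr.etaComp) y α β) x :=
    fun _ _ ↦ differentiableAt_const _
  have hH := fun α β ↦ Kerr.abs_inverseMetric_sub_eta_apply_le hM hr α β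
  have hdH := fun μ α β ↦
    Kerr.abs_fderiv_inverseMetric_sub_eta_basisVector_le_of_abs_le hM hr hax μ α β
  have hU₁ := fun ν ↦ abs_fderiv_largeRWeight_le (x := x) hδ0 hδ1 hρ1 ν
  have hU₂ := fun μ ν ↦ abs_fderiv_fderiv_largeRWeight_le (x := x) hδ0 hδ1 hρ1 μ ν
  have hpert := abs_waveOperator_sub_le hG hG' (contDiffAt_largeRWeight δ hρ) hH hdH hU₁ hU₂
  clear hG hG' hH hdH hU₁ hU₂
  obtain ⟨Wg, hWg⟩ : ∃ Wg : ℝ, waveOperator (Kerr.inverseMetric M a) (fun y : E4 ↦ 4 * ((E4.spatialNorm y ^ 2) ^ (-(1 / 2 : ℝ)) -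
      (E4.spatialNorm y ^ 2) ^ (-((1 + δ) / 2)) + δ / 2 * (E4.spatialNorm y ^ 2) ^ (-((1 + 2 * δ) / 2)))) x = Wg := ⟨_, rfl⟩
  obtain ⟨Wη, hWη⟩ : ∃ Wη : ℝ, waveOperator (fun _ : E4 ↦ Kerr.etaComp) (fun y : E4 ↦ 4 * ((E4.spatialNorm y ^ 2) ^ (-(1 / 2 : ℝ)) -
      (E4.spatialNorm y ^ 2) ^ (-((1 + δ) / 2)) + δ / 2 * (E4.spatialNorm y ^ 2) ^ (-((1 + 2 * δ) / 2)))) x = Wη := ⟨_, rfl⟩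
  rw [hWg, hWη] at hpert
  rw [hWη] at hmodel
  rw [hWg]
  have hlow := (abs_le.1 hpert).2
  -- the error `2(216M/r² · 18/ρ² + 2M/r · 92/ρ³) ≤ 8144 M/r⁴`
  have hρK : (E4.spatialNorm x)⁻¹ ≤ (Kerr.radius a x)⁻¹ := inv_anti₀ hr hrρ
  have hρK2 : (E4.spatialNorm x ^ 2)⁻¹ ≤ (Kerr.radius a x ^ 2)⁻¹ :=
    inv_anti₀ (by positivity) (by gcongr)
  have hρK3 : (E4.spatialNorm x ^ 3)⁻¹ ≤ (Kerr.radius a x ^ 3)⁻¹ :=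
    inv_anti₀ (by positivity) (by gcongr)
  have t1 : 216 * M / Kerr.radius a x ^ 2 * (18 / E4.spatialNorm x ^ 2) ≤
      216 * M / Kerr.radius a x ^ 2 * (18 / Kerr.radius a x ^ 2) := by
    rw [div_eq_mul_inv (18 : ℝ), div_eq_mul_inv (18 : ℝ)]
    gcongr
  have t2 : 2 * M / Kerr.radius a x * (92 / E4.spatialNorm x ^ 3) ≤
      2 * M / Kerr.radius a x * (92 / Kerr.radius a x ^ 3) := by
    rw [div_eq_mul_inv (92 : ℝ), div_eq_mul_inv (92 : ℝ)]
    gcongr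
  have hid : 8144 * M / Kerr.radius a x ^ 4 =
      8⁻¹ * (16 * (216 * M / Kerr.radius a x ^ 2 * (18 / Kerr.radius a x ^ 2) +
        2 * M / Kerr.radius a x * (92 / Kerr.radius a x ^ 3))) := by
    field_simp
    ring
  rw [hid]
  linarith [t1, t2, hlow, hmodel]

/-- **The same with the Kerr–Schild radius throughout**: for `r = r(x) ≥ 2^{1/δ}`, `r ≥ |a|`,
`−⅛ □_g ϖ_δ (x) ≥ (δ/64) r^{−3−δ} − 8144 M/r⁴` (`|y⃗| ≤ 2r`, `(2r)^{−3−δ} ≥ r^{−3−δ}/16`).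
[cite: DafermosRodnianskiShlapentokhrothman2014, §4.6] -/
theorem kerr_largeR_zerothOrder_lower_bound_radius {δ M a : ℝ} (hδ0 : 0 < δ) (hδ1 : δ ≤ 1)
    (hM : 0 ≤ M) {x : E4} (hx : (2 : ℝ) ^ (1 / δ) ≤ Kerr.radius a x)
    (hax : |a| ≤ Kerr.radius a x) :
    δ / 64 * Kerr.radius a x ^ (-3 - δ) - 8144 * M / Kerr.radius a x ^ 4 ≤
      -8⁻¹ * waveOperator (Kerr.inverseMetric M a) (fun y : E4 ↦ 4 * ((E4.spatialNorm y ^ 2) ^ (-(1 / 2 : ℝ)) -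
      (E4.spatialNorm y ^ 2) ^ (-((1 + δ) / 2)) + δ / 2 * (E4.spatialNorm y ^ 2) ^ (-((1 + 2 * δ) / 2)))) x := by
  have h2 : 0 < (2 : ℝ) ^ (1 / δ) := Real.rpow_pos_of_pos (by norm_num) _
  have hr : 0 < Kerr.radius a x := h2.trans_le hx
  have hr' : 0 < Kerr.radius a (E4.ofTimeSpace 0 (E4.spatial x)) := by
    rwa [Kerr.radius_ofTimeSpace_spatial]
  have hrρ : Kerr.radius a x ≤ E4.spatialNorm x := by
    have h := Kerr.radius_le_norm hr'
    rwa [Kerr.radius_ofTimeSpace_spatial] at h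
  have hρr : E4.spatialNorm x ≤ 2 * Kerr.radius a x := by
    have h := Kerr.norm_le_radius_add_abs hr'
    rw [Kerr.radius_ofTimeSpace_spatial] at h
    change E4.spatialNorm x ≤ _ at h
    linarith
  have hmain := kerr_largeR_zerothOrder_lower_bound hδ0 hδ1 hM (hx.trans hrρ) hr hax
  refine le_trans ?_ hmain
  have hpow : E4.spatialNorm x ^ (-3 - δ) ≥ (2 * Kerr.radius a x) ^ (-3 - δ) :=
    Real.rpow_le_rpow_of_nonpos (hr.trans_le hrρ) hρr (by linarith)
  have hsplit : (2 * Kerr.radius a x) ^ (-3 - δ) = (2 : ℝ) ^ (-3 - δ) * Kerr.radius a x ^ (-3 - δ) :=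
    Real.mul_rpow zero_le_two hr.le
  have h2pow : (1 / 16 : ℝ) ≤ (2 : ℝ) ^ (-3 - δ) := by
    calc (1 / 16 : ℝ) = (2 : ℝ) ^ (-4 : ℝ) := by
          rw [Real.rpow_neg zero_le_two, show (4 : ℝ) = ((4 : ℕ) : ℝ) by norm_num, Real.rpow_natCast]
          norm_num
      _ ≤ (2 : ℝ) ^ (-3 - δ) := Real.rpow_le_rpow_of_exponent_le one_le_two (by linarith)
  have hK0 : 0 ≤ Kerr.radius a x ^ (-3 - δ) := Real.rpow_nonneg hr.le _
  have h3 : 1 / 16 * Kerr.radius a x ^ (-3 - δ) ≤ E4.spatialNorm x ^ (-3 - δ) :=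
    calc 1 / 16 * Kerr.radius a x ^ (-3 - δ) ≤ (2 : ℝ) ^ (-3 - δ) * Kerr.radius a x ^ (-3 - δ) :=
          mul_le_mul_of_nonneg_right h2pow hK0
      _ = (2 * Kerr.radius a x) ^ (-3 - δ) := hsplit.symm
      _ ≤ E4.spatialNorm x ^ (-3 - δ) := hpow
  have h4 := mul_le_mul_of_nonneg_left h3 (by positivity : (0 : ℝ) ≤ δ / 4)
  linarith

/-- **Coercivity of the zeroth-order term for large `r`**: under the hypotheses of
`kerr_largeR_zerothOrder_lower_bound_radius`, if moreover `δ r^{1−δ} ≥ 1042432 M` (i.e.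
`8144 M/r⁴ ≤ (δ/128) r^{−3−δ}`), then `−⅛ □_{g_{M,a}} ϖ_δ (x) ≥ (δ/128) r^{−3−δ}` — with
`KerrSchild.kerr_largeR_firstOrder_coercive` this makes the divergence of the modified current
`J^X + ¼L_ϖ` of a solution of `□_g w = 0` bounded below by
`(δ/32) r^{−1−δ} ∑(∂w)² + (δ/128) r^{−3−δ} w²` in the far region, the Kerr form of the large-`r`
estimate of Dafermos–Rodnianski (arXiv:1010.5132, §6; DRSR arXiv:1402.7034, §4.6, Prop. 4.6.1).
[cite: DafermosRodnianskiShlapentokhrothman2014, §4.6] -/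
theorem kerr_largeR_zerothOrder_coercive {δ M a : ℝ} (hδ0 : 0 < δ) (hδ1 : δ ≤ 1) (hM : 0 ≤ M)
    {x : E4} (hx : (2 : ℝ) ^ (1 / δ) ≤ Kerr.radius a x) (hax : |a| ≤ Kerr.radius a x)
    (hlarge : 1042432 * M ≤ δ * Kerr.radius a x ^ (1 - δ)) :
    δ / 128 * Kerr.radius a x ^ (-3 - δ) ≤
      -8⁻¹ * waveOperator (Kerr.inverseMetric M a) (fun y : E4 ↦ 4 * ((E4.spatialNorm y ^ 2) ^ (-(1 / 2 : ℝ)) -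
      (E4.spatialNorm y ^ 2) ^ (-((1 + δ) / 2)) + δ / 2 * (E4.spatialNorm y ^ 2) ^ (-((1 + 2 * δ) / 2)))) x := by
  have h2 : 0 < (2 : ℝ) ^ (1 / δ) := Real.rpow_pos_of_pos (by norm_num) _
  have hr : 0 < Kerr.radius a x := h2.trans_le hx
  refine le_trans ?_ (kerr_largeR_zerothOrder_lower_bound_radius hδ0 hδ1 hM hx hax)
  set r := Kerr.radius a x with hr_def
  have hpow : r ^ (1 - δ) = r ^ (-3 - δ) * r ^ 4 := by
    rw [show r ^ 4 = r ^ (4 : ℝ) by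
      rw [show (4 : ℝ) = ((4 : ℕ) : ℝ) by norm_num, Real.rpow_natCast], ← Real.rpow_add hr]
    ring_nf
  have hr4 : 0 < r ^ 4 := by positivity
  have hkey : 8144 * M / r ^ 4 ≤ δ / 128 * r ^ (-3 - δ) := by
    rw [div_le_iff₀ hr4]
    rw [hpow] at hlarge
    linarith
  linarith

end KerrSchild

end Literature.Geometry.Lorentzian

end
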